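import Summits.Ventures.Crystal3D.Theorems.StickyWulffConstantCoaxialWallLawEndClasses
import HarnessLib

/-!
# Exact end accounting for the word automaton, V: at most two states reach a ball from each of its neighbours

HONEST FRAMING. Part of the venture `Summits/Ventures/Crystal3D` (cell `crystal3d-full`), helper for the crux
`CoaxialWallLaw` (stmt-Ventures-19481) of `route-Ventures-StickyWulffConstant`, REGISTERED line `WallLedgerF`
(planner cf-p1 gen 16), open stub `stub_coaxialTwoSlabAdhesion` (general fillings).  Rung credit only; F-C1 not
moved.  A CRUDE but honest bound on the END MULTIPLICITY of the exact count (`…ExactCount`): the reachable ends at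
one ball `b` are images `f u` of MOVING states `u` at neighbours of `b` (`word_move_target`: `dist u.1 b = 1`), and
by `…EndClasses` a moving state's ball carries at most two certified states:

* `card_states_le_two_of_moving` — at most TWO certified states sit on the ball of a moving state (one on a full
  shell; on a twin-reading ball the own class and at most one mirrored class, any two mirrored classes being equal
  by `image_fccSlots_eq_of_triangle` + `hrigid`);
* **`card_reached_at_le`** — the states `(b, κ) ∈ W` that are images of moving states number at most
  `2 · #{q ∈ X : dist b q = 1}` (`≤ 22` at a reachable end, which is unsaturated by `…EndCharge`).

So, with `…EndCharge`, the exact count charges `≤ 22` ends to each unsaturated ball of the window instead of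
`13 · 220`: the constant of the residual-free laws improves by the factor `130` (next: instantiation, assembly).
The SHARP multiplicity (k-fold tops: `k = 1` C12-55, `k = 2` non-co-axial `DoubleTopFar`, co-axial excluded by
`…EndGap`, `k ≥ 3` a census question) is NOT attempted here.

WHAT THIS IS NOT: not the stub; F-C1 not moved.
-/

noncomputable section

namespace Summit.Ventures.Crystal3D.Theorems

open Summit.Ventures.Crystal3D Finset
open Literature.MathematicalPhysics.StatisticalMechanics (fccStacking)
open scoped InnerProductSpace

variable {X : Finset (EuclideanSpace ℝ (Fin 3))}

section Word

variable {K : Type*} {F : K → (EuclideanSpace ℝ (Fin 3) ≃ₗᵢ[ℝ] EuclideanSpace ℝ (Fin 3))}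
  {d : K → EuclideanSpace ℝ (Fin 3)} {next : K → EuclideanSpace ℝ (Fin 3) → K}
  {W : Finset (EuclideanSpace ℝ (Fin 3) × K)}
  {f : EuclideanSpace ℝ (Fin 3) × K → EuclideanSpace ℝ (Fin 3) × K}

open scoped Classical in
/-- **At most two certified states sit on the ball of a MOVING state.** -/
theorem card_states_le_two_of_moving (hX : ∀ p ∈ X, ∀ q ∈ X, p ≠ q → 1 ≤ dist p q)
    (hW : ∀ v, v ∈ W ↔ (v.1 ∈ X ∧
      (∃ a ∈ fccSlots, ∃ a' ∈ fccSlots, ∃ a'' ∈ fccSlots,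
        ⟪a, a'⟫_ℝ = 1 / 2 ∧ ⟪a, a''⟫_ℝ = 1 / 2 ∧ ⟪a', a''⟫_ℝ = 1 / 2 ∧
        v.1 + F v.2 a ∈ X ∧ v.1 + F v.2 a' ∈ X ∧ v.1 + F v.2 a'' ∈ X) ∧
      v.1 - d v.2 ∈ X))
    (hrigid : ∀ κ₁ κ₂ : K, (∃ a ∈ fccSlots, ∃ a' ∈ fccSlots, ∃ a'' ∈ fccSlots,
        ⟪a, a'⟫_ℝ = 1 / 2 ∧ ⟪a, a''⟫_ℝ = 1 / 2 ∧ ⟪a', a''⟫_ℝ = 1 / 2 ∧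
        (∃ w ∈ fccSlots, F κ₂ w = F κ₁ a) ∧ (∃ w ∈ fccSlots, F κ₂ w = F κ₁ a') ∧
        (∃ w ∈ fccSlots, F κ₂ w = F κ₁ a'')) → κ₁ = κ₂)
    {u : EuclideanSpace ℝ (Fin 3) × K}
    (hmov : (∀ w ∈ fccSlots, u.1 + F u.2 w ∈ X) ∨
      ∃ m : EuclideanSpace ℝ (Fin 3), ‖m‖ = 1 ∧
        (∀ w ∈ fccSlots, ⟪F u.2 w, m⟫_ℝ = 0 ∨ ⟪F u.2 w, m⟫_ℝ = Real.sqrt (2 / 3) ∨ ⟪F u.2 w, m⟫_ℝ = -Real.sqrt (2 / 3)) ∧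
        (∀ w ∈ fccSlots, ⟪F u.2 w, m⟫_ℝ ≤ 0 → u.1 + F u.2 w ∈ X) ∧
        (∀ w ∈ fccSlots, ⟪F u.2 w, m⟫_ℝ < 0 → u.1 + (F u.2 w - (2 * ⟪F u.2 w, m⟫_ℝ) • m) ∈ X) ∧
        (∀ w ∈ fccSlots, 0 < ⟪F u.2 w, m⟫_ℝ → u.1 + F u.2 w ∉ X) ∧
        (⟪d u.2, m⟫_ℝ = Real.sqrt (2 / 3) ∨ ⟪d u.2, m⟫_ℝ = 0)) :
    (W.filter fun v => v.1 = u.1).card ≤ 2 := by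
  -- states at a ball are determined by their class
  have hinj : ∀ v ∈ W.filter (fun v => v.1 = u.1), ∀ v' ∈ W.filter (fun v => v.1 = u.1), v.2 = v'.2 → v = v' := by
    intro v hv v' hv' h
    exact Prod.ext ((mem_filter.1 hv).2.trans (mem_filter.1 hv').2.symm) h
  rcases hmov with hfull | ⟨m, hm, hmenu, hown, hmir, -, -⟩
  · -- full shell: only the class of `u`
    refine (Finset.card_le_one.2 fun v hv v' hv' => ?_).trans one_le_two
    exact hinj v hv v' hv' ((word_class_eq_of_full hX hW hrigid hfull (mem_filter.1 hv).1 (mem_filter.1 hv).2).trans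
      (word_class_eq_of_full hX hW hrigid hfull (mem_filter.1 hv').1 (mem_filter.1 hv').2).symm)
  · -- twin reading: the class of `u` and at most one mirrored class
    set L : EuclideanSpace ℝ (Fin 3) ≃ₗᵢ[ℝ] EuclideanSpace ℝ (Fin 3) := (F u.2).trans (ℝ ∙ m)ᗮ.reflection with hL
    -- two mirrored classes coincide
    have hmirr_eq : ∀ v ∈ W.filter (fun v => v.1 = u.1), ∀ v' ∈ W.filter (fun v => v.1 = u.1),
        v.2 ≠ u.2 → v'.2 ≠ u.2 → v = v' := by
      intro v hv v' hv' hne hne'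
      obtain ⟨hvW, hvp⟩ := mem_filter.1 hv
      obtain ⟨hv'W, hv'p⟩ := mem_filter.1 hv'
      rcases word_class_of_twinDozen hX hW hrigid hm hmenu hown hmir hvW hvp with h | ⟨a, ha, a', ha', a'', ha'', i1, i2, i3, m1, m2, m3⟩
      · exact absurd h hne
      rcases word_class_of_twinDozen hX hW hrigid hm hmenu hown hmir hv'W hv'p with h' | ⟨b, hb, b', hb', b'', hb'', j1, j2, j3, n1, n2, n3⟩
      · exact absurd h' hne'
      have hIm := image_fccSlots_eq_of_triangle (F v.2) L ha ha' ha'' i1 i2 i3 m1 m2 m3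
      have hIm' := image_fccSlots_eq_of_triangle (F v'.2) L hb hb' hb'' j1 j2 j3 n1 n2 n3
      have hmem : ∀ {x : EuclideanSpace ℝ (Fin 3)}, x ∈ fccSlots → ∃ w ∈ fccSlots, F v'.2 w = F v.2 x := by
        intro x hx
        have : F v.2 x ∈ (F v'.2 : EuclideanSpace ℝ (Fin 3) → EuclideanSpace ℝ (Fin 3)) '' ↑fccSlots := by
          rw [hIm', ← hIm]; exact ⟨x, Finset.mem_coe.2 hx, rfl⟩
        obtain ⟨w, hw, hwe⟩ := this
        exact ⟨w, Finset.mem_coe.1 hw, hwe⟩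
      exact hinj v hv v' hv' (hrigid v.2 v'.2 ⟨a, ha, a', ha', a'', ha'', i1, i2, i3, hmem ha, hmem ha', hmem ha''⟩)
    -- hence at most two states
    by_cases hex : ∃ v₀ ∈ W.filter (fun v => v.1 = u.1), v₀.2 ≠ u.2
    · obtain ⟨v₀, hv₀, hne₀⟩ := hex
      have hsub : W.filter (fun v => v.1 = u.1) ⊆ {(u.1, u.2), v₀} := by
        intro v hv
        rw [mem_insert, mem_singleton]
        by_cases h : v.2 = u.2
        · exact Or.inl (Prod.ext (mem_filter.1 hv).2 h)
        · exact Or.inr (hmirr_eq v hv v₀ hv₀ h hne₀)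
      exact (card_le_card hsub).trans (card_insert_le _ _ |>.trans (by rw [card_singleton]))
    · push Not at hex
      refine (Finset.card_le_one.2 fun v hv v' hv' => ?_).trans one_le_two
      exact hinj v hv v' hv' ((hex v hv).trans (hex v' hv').symm)

open scoped Classical in
/-- **The number of states REACHED at a ball is at most twice its degree.**  With the move data of
`…WordCore` (`word_move_target`: a move is a unit step, its image certified): the certified states at `b` that are
images of MOVING states number at most `2 · #{q ∈ X : dist b q = 1}`. -/
theorem card_reached_at_le (hX : ∀ p ∈ X, ∀ q ∈ X, p ≠ q → 1 ≤ dist p q)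
    (hd : ∀ κ, ∃ u ∈ fccSlots, d κ = F κ u)
    (hdn : ∀ κ, ∃ m : EuclideanSpace ℝ (Fin 3), ‖m‖ = 1 ∧
      (∀ w ∈ fccSlots, ⟪F κ w, m⟫_ℝ = 0 ∨ ⟪F κ w, m⟫_ℝ = Real.sqrt (2 / 3) ∨ ⟪F κ w, m⟫_ℝ = -Real.sqrt (2 / 3)) ∧
      ⟪d κ, m⟫_ℝ = Real.sqrt (2 / 3))
    (hmirror : ∀ κ (m : EuclideanSpace ℝ (Fin 3)), ‖m‖ = 1 →
      (∀ w ∈ fccSlots, ⟪F κ w, m⟫_ℝ = 0 ∨ ⟪F κ w, m⟫_ℝ = Real.sqrt (2 / 3) ∨ ⟪F κ w, m⟫_ℝ = -Real.sqrt (2 / 3)) →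
      ⟪d κ, m⟫_ℝ = Real.sqrt (2 / 3) → ∀ x, F (next κ m) x = F κ x - (2 * ⟪F κ x, m⟫_ℝ) • m)
    (hdnext : ∀ κ (m : EuclideanSpace ℝ (Fin 3)), ‖m‖ = 1 →
      (∀ w ∈ fccSlots, ⟪F κ w, m⟫_ℝ = 0 ∨ ⟪F κ w, m⟫_ℝ = Real.sqrt (2 / 3) ∨ ⟪F κ w, m⟫_ℝ = -Real.sqrt (2 / 3)) →
      ⟪d κ, m⟫_ℝ = Real.sqrt (2 / 3) → ⟪d (next κ m), m⟫_ℝ = Real.sqrt (2 / 3))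
    (hW : ∀ v, v ∈ W ↔ (v.1 ∈ X ∧
      (∃ a ∈ fccSlots, ∃ a' ∈ fccSlots, ∃ a'' ∈ fccSlots,
        ⟪a, a'⟫_ℝ = 1 / 2 ∧ ⟪a, a''⟫_ℝ = 1 / 2 ∧ ⟪a', a''⟫_ℝ = 1 / 2 ∧
        v.1 + F v.2 a ∈ X ∧ v.1 + F v.2 a' ∈ X ∧ v.1 + F v.2 a'' ∈ X) ∧
      v.1 - d v.2 ∈ X))
    (hf_full : ∀ v ∈ W, (∀ w ∈ fccSlots, v.1 + F v.2 w ∈ X) → f v = (v.1 + d v.2, v.2))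
    (hf_cross : ∀ v ∈ W, ∀ m : EuclideanSpace ℝ (Fin 3), ‖m‖ = 1 →
      (∀ w ∈ fccSlots, ⟪F v.2 w, m⟫_ℝ = 0 ∨ ⟪F v.2 w, m⟫_ℝ = Real.sqrt (2 / 3) ∨ ⟪F v.2 w, m⟫_ℝ = -Real.sqrt (2 / 3)) →
      (∀ w ∈ fccSlots, ⟪F v.2 w, m⟫_ℝ ≤ 0 → v.1 + F v.2 w ∈ X) →
      (∀ w ∈ fccSlots, ⟪F v.2 w, m⟫_ℝ < 0 → v.1 + (F v.2 w - (2 * ⟪F v.2 w, m⟫_ℝ) • m) ∈ X) →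
      (∀ w ∈ fccSlots, 0 < ⟪F v.2 w, m⟫_ℝ → v.1 + F v.2 w ∉ X) →
      ⟪d v.2, m⟫_ℝ = Real.sqrt (2 / 3) → f v = (v.1 + d (next v.2 m), next v.2 m))
    (hf_glide : ∀ v ∈ W, ∀ m : EuclideanSpace ℝ (Fin 3), ‖m‖ = 1 →
      (∀ w ∈ fccSlots, ⟪F v.2 w, m⟫_ℝ = 0 ∨ ⟪F v.2 w, m⟫_ℝ = Real.sqrt (2 / 3) ∨ ⟪F v.2 w, m⟫_ℝ = -Real.sqrt (2 / 3)) →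
      (∀ w ∈ fccSlots, ⟪F v.2 w, m⟫_ℝ ≤ 0 → v.1 + F v.2 w ∈ X) →
      (∀ w ∈ fccSlots, ⟪F v.2 w, m⟫_ℝ < 0 → v.1 + (F v.2 w - (2 * ⟪F v.2 w, m⟫_ℝ) • m) ∈ X) →
      (∀ w ∈ fccSlots, 0 < ⟪F v.2 w, m⟫_ℝ → v.1 + F v.2 w ∉ X) →
      ⟪d v.2, m⟫_ℝ = 0 → f v = (v.1 + d v.2, v.2))
    (hrigid : ∀ κ₁ κ₂ : K, (∃ a ∈ fccSlots, ∃ a' ∈ fccSlots, ∃ a'' ∈ fccSlots,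
        ⟪a, a'⟫_ℝ = 1 / 2 ∧ ⟪a, a''⟫_ℝ = 1 / 2 ∧ ⟪a', a''⟫_ℝ = 1 / 2 ∧
        (∃ w ∈ fccSlots, F κ₂ w = F κ₁ a) ∧ (∃ w ∈ fccSlots, F κ₂ w = F κ₁ a') ∧
        (∃ w ∈ fccSlots, F κ₂ w = F κ₁ a'')) → κ₁ = κ₂)
    (b : EuclideanSpace ℝ (Fin 3)) :
    (W.filter fun v => v.1 = b ∧ ∃ u ∈ W, ((∀ w ∈ fccSlots, u.1 + F u.2 w ∈ X) ∨
        ∃ m : EuclideanSpace ℝ (Fin 3), ‖m‖ = 1 ∧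
          (∀ w ∈ fccSlots, ⟪F u.2 w, m⟫_ℝ = 0 ∨ ⟪F u.2 w, m⟫_ℝ = Real.sqrt (2 / 3) ∨ ⟪F u.2 w, m⟫_ℝ = -Real.sqrt (2 / 3)) ∧
          (∀ w ∈ fccSlots, ⟪F u.2 w, m⟫_ℝ ≤ 0 → u.1 + F u.2 w ∈ X) ∧
          (∀ w ∈ fccSlots, ⟪F u.2 w, m⟫_ℝ < 0 → u.1 + (F u.2 w - (2 * ⟪F u.2 w, m⟫_ℝ) • m) ∈ X) ∧
          (∀ w ∈ fccSlots, 0 < ⟪F u.2 w, m⟫_ℝ → u.1 + F u.2 w ∉ X) ∧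
          (⟪d u.2, m⟫_ℝ = Real.sqrt (2 / 3) ∨ ⟪d u.2, m⟫_ℝ = 0)) ∧ f u = v).card ≤
      2 * (X.filter fun q => dist b q = 1).card := by
  set mov : EuclideanSpace ℝ (Fin 3) × K → Prop := fun u => (∀ w ∈ fccSlots, u.1 + F u.2 w ∈ X) ∨
      ∃ m : EuclideanSpace ℝ (Fin 3), ‖m‖ = 1 ∧
        (∀ w ∈ fccSlots, ⟪F u.2 w, m⟫_ℝ = 0 ∨ ⟪F u.2 w, m⟫_ℝ = Real.sqrt (2 / 3) ∨ ⟪F u.2 w, m⟫_ℝ = -Real.sqrt (2 / 3)) ∧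
        (∀ w ∈ fccSlots, ⟪F u.2 w, m⟫_ℝ ≤ 0 → u.1 + F u.2 w ∈ X) ∧
        (∀ w ∈ fccSlots, ⟪F u.2 w, m⟫_ℝ < 0 → u.1 + (F u.2 w - (2 * ⟪F u.2 w, m⟫_ℝ) • m) ∈ X) ∧
        (∀ w ∈ fccSlots, 0 < ⟪F u.2 w, m⟫_ℝ → u.1 + F u.2 w ∉ X) ∧
        (⟪d u.2, m⟫_ℝ = Real.sqrt (2 / 3) ∨ ⟪d u.2, m⟫_ℝ = 0) with hmov
  set T := W.filter fun v => v.1 = b ∧ ∃ u ∈ W, mov u ∧ f u = v with hT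
  set U := W.filter fun u => mov u ∧ (f u).1 = b with hU
  set N := X.filter fun q => dist b q = 1 with hN
  -- every reached state is the image of a moving state aimed at `b`
  have hTU : T ⊆ U.image f := by
    intro v hv
    obtain ⟨-, hvb, u, huW, hum, hfu⟩ := mem_filter.1 hv
    exact mem_image.2 ⟨u, mem_filter.2 ⟨huW, hum, by rw [hfu]; exact hvb⟩, hfu⟩
  -- a moving state aimed at `b` sits on a neighbour of `b`
  have hUN : U ⊆ N.biUnion fun p => W.filter fun u => u.1 = p := by
    intro u hu
    obtain ⟨huW, hum, hfb⟩ := mem_filter.1 hu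
    obtain ⟨-, -, hdist⟩ := word_move_target hd hdn hmirror hdnext hW hf_full hf_cross hf_glide huW hum
    rw [mem_biUnion]
    refine ⟨u.1, mem_filter.2 ⟨((hW u).1 huW).1, ?_⟩, mem_filter.2 ⟨huW, rfl⟩⟩
    rw [← hfb, dist_comm]; exact hdist
  -- and each such neighbour carries at most two states, all the more at most two MOVING… we bound all states
  have hfib : ∀ p ∈ N, ((W.filter fun u => u.1 = p) ∩ U).card ≤ 2 := by
    intro p hp
    by_cases hne : ((W.filter fun u => u.1 = p) ∩ U).Nonempty
    · obtain ⟨u₀, hu₀⟩ := hne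
      obtain ⟨hu₀p, hu₀U⟩ := mem_inter.1 hu₀
      obtain ⟨-, hum₀, -⟩ := mem_filter.1 hu₀U
      have hp₀ : u₀.1 = p := (mem_filter.1 hu₀p).2
      have h2 := card_states_le_two_of_moving hX hW hrigid hum₀
      rw [hp₀] at h2
      exact (card_le_card inter_subset_left).trans h2
    · rw [not_nonempty_iff_eq_empty.1 hne, card_empty]; exact zero_le_two
  calc T.card ≤ (U.image f).card := card_le_card hTU
    _ ≤ U.card := card_image_le
    _ ≤ (N.biUnion fun p => (W.filter fun u => u.1 = p) ∩ U).card := by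
        refine card_le_card fun u hu => ?_
        have := hUN hu
        rw [mem_biUnion] at this ⊢
        obtain ⟨p, hp, hup⟩ := this
        exact ⟨p, hp, mem_inter.2 ⟨hup, hu⟩⟩
    _ ≤ ∑ p ∈ N, ((W.filter fun u => u.1 = p) ∩ U).card := card_biUnion_le
    _ ≤ ∑ p ∈ N, 2 := sum_le_sum hfib
    _ = 2 * N.card := by rw [sum_const, smul_eq_mul, mul_comm]

end Word

end Summit.Ventures.Crystal3D.Theorems

end
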